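import Mathlib
import Summits.KontsevichZagierPeriods.Zeta5Search.LaiDecaySplit
import Summits.KontsevichZagierPeriods.Zeta5Search.LaiBoxUnimodal
import HarnessLib

/-!
# ζ(5) search — the profile maximum (`isMax`) of the decay split, from the kernel unimodality certificate
# (fam-indep, κ₃ ladder, gen 5)

HONEST FRAMING: systematic search; no irrationality claim unless certified.

OUR work (Summit side; cell `pub-zeta5`, family `indep`, planner seat gen 5, STAGED for the lane). Target (D2) of
`LaiDecaySplit`: the field `isMax : ∀ x > r, f x ≤ f x₀` of `LaiDecayInputs`, for the sum-side profile
`f = laiProfile J r M δ` (families/indep/DECAY-L1.md §2, Lemma 2.2). PROVED here, generically in `(J, r, M, δ)`: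

* `hasDerivAt_laiProfile` — for `x > r` (and `δ_j ≤ M`), `f` is differentiable with derivative `laiProfileDeriv`, and
  `laiProfileDeriv_eq`: `f'(x) = log L(x) − log R(x)` with `L(x) = x(x+M+r)∏_j(x+δ_j)` (`laiProfL`) and
  `R(x) = (x−r)(x+M)∏_j(x+M−δ_j)` (`laiProfR`) — DECAY-L1 Lemma 2.2 (`f' = log(L/R)`);
* `laiProfile_isMax_of_sign` — if `R ≤ L` on `(r, r+X₀)` and `L ≤ R` on `(r+X₀, ∞)` then `f ≤ f(r+X₀)` on `(r,∞)`
  (mean value theorem: `monotoneOn_of_hasDerivWithinAt_nonneg` / `antitoneOn_of_hasDerivWithinAt_nonpos`);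
* `laiA_prod_eq`, `laiB_prod_eq` — `L(r+X)`, `R(r+X)` ARE the two sides of Lai's balance equation in the tree's
  `LaiBoxUnimodal.laiA/laiB` form; `strictAnti_of_domCheck` — the tree's certificate `domCheck` makes `L − R` strictly
  decreasing on `[0,∞)` (the argument inside `LaiBoxUnimodal.existsUnique_pos_root_of_domCheck`, re-exported);
* **`laiProfile_isMax_of_domCheck`** — `domCheck (linProdCoeffs (laiA r M δ)) (linProdCoeffs (laiB r M δ)) = true` and
  `δ_j ≤ M` give `∃ X₀ > 0`, the balance root, with `∀ x > r, f x ≤ f (r + X₀)`;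
* **`kappa3_profile_isMax`** — the ladder point `(J, r, M) = (74, 2180, 444)`, `δ = delta74` (tree `domCheck74`,
  p241620): for every `δ : Fin 74 → ℕ` listing `delta74`, the profile has its maximum on `(2180, ∞)` at `2180 + X₀`,
  `X₀` the unique positive balance root. This discharges `isMax` (with `x₀ := 2180 + X₀`) of the κ₃ decay inputs.

MANUSCRIPT-LEVEL CANDIDATE context only ('κ₃ ≤ 73'): this file is calculus about the profile; no decay rate, margin or
dimension statement is made, and no instance of `LaiDecayInputs` is constructed.

References: [Lai2024BallRivoal] L. Lai, arXiv:2407.14236, p. 48–49 (the balance equation and its positive root);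
families/indep/DECAY-L1.md §2 Lemma 2.2; tree `LaiBoxUnimodal` (p241620), `LaiDecaySplit` (FR 11).
-/

open Finset Set
open scoped Topology

namespace Summit.KontsevichZagierPeriods.Zeta5Search

open LaiBoxUnimodal

noncomputable section

variable {J r M : ℕ} {δ : Fin J → ℕ}

/-! ### The derivative of the profile -/

/-- `d/dy (y log y) = log y + 1` away from `0`. [folklore] -/
theorem hasDerivAt_xlnx {y : ℝ} (hy : y ≠ 0) : HasDerivAt xlnx (Real.log y + 1) y :=
  Real.hasDerivAt_mul_log hy

/-- Chain rule for `y log y` along an inner function. [folklore] -/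
theorem hasDerivAt_xlnx_comp {g : ℝ → ℝ} {g' x : ℝ} (hg : HasDerivAt g g' x) (hne : g x ≠ 0) :
    HasDerivAt (fun y => xlnx (g y)) ((Real.log (g x) + 1) * g') x := by
  have := (hasDerivAt_xlnx hne).comp x hg
  simpa [Function.comp_def] using this

/-- The derivative of the profile on `(r, ∞)` (before collecting into `log L − log R`). [this file] -/
def laiProfileDeriv (J r M : ℕ) (δ : Fin J → ℕ) (x : ℝ) : ℝ :=
  Real.log x - Real.log (x - r) + Real.log (x + M + r) - Real.log (x + M) -
    ∑ j : Fin J, (Real.log (x + M - δ j) - Real.log (x + δ j))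

/-- `L(x) = x (x+M+r) ∏_j (x+δ_j)` — the 'left' side of Lai's balance equation in the variable `x = r + X`.
[cite: Lai2024BallRivoal, p. 49] (our form) -/
def laiProfL (J r M : ℕ) (δ : Fin J → ℕ) (x : ℝ) : ℝ := x * (x + M + r) * ∏ j : Fin J, (x + δ j)

/-- `R(x) = (x−r)(x+M) ∏_j (x+M−δ_j)` — the 'right' side of Lai's balance equation in the variable `x = r + X`.
[cite: Lai2024BallRivoal, p. 49] (our form) -/
def laiProfR (J r M : ℕ) (δ : Fin J → ℕ) (x : ℝ) : ℝ := (x - r) * (x + M) * ∏ j : Fin J, (x + M - δ j)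

/-- `L > 0` on `(0, ∞)`. [this file] -/
theorem laiProfL_pos {x : ℝ} (hx : 0 < x) : 0 < laiProfL J r M δ x := by
  unfold laiProfL
  exact mul_pos (by positivity) (prod_pos fun j _ => by positivity)

/-- `R > 0` on `(r, ∞)` when `δ_j ≤ M`. [this file] -/
theorem laiProfR_pos (hδ : ∀ j, δ j ≤ M) {x : ℝ} (hx : (r : ℝ) < x) : 0 < laiProfR J r M δ x := by
  have hx0 : 0 < x := lt_of_le_of_lt (Nat.cast_nonneg r) hx
  unfold laiProfR
  refine mul_pos (mul_pos (by linarith) (by positivity)) (prod_pos fun j _ => ?_)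
  have : (δ j : ℝ) ≤ M := by exact_mod_cast hδ j
  linarith

/-- **DECAY-L1 Lemma 2.2, first half**: the profile is differentiable on `(r, ∞)` with derivative `laiProfileDeriv`.
[this file] -/
theorem hasDerivAt_laiProfile (hδ : ∀ j, δ j ≤ M) {x : ℝ} (hx : (r : ℝ) < x) :
    HasDerivAt (laiProfile J r M δ) (laiProfileDeriv J r M δ x) x := by
  have hx0 : 0 < x := lt_of_le_of_lt (Nat.cast_nonneg r) hx
  have hδ' : ∀ j, (δ j : ℝ) ≤ M := fun j => by exact_mod_cast hδ j
  have h1 : HasDerivAt (fun y : ℝ => y) 1 x := hasDerivAt_id' x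
  have hA : HasDerivAt (fun y : ℝ => xlnx y) ((Real.log x + 1) * 1) x := hasDerivAt_xlnx_comp h1 hx0.ne'
  have hB : HasDerivAt (fun y : ℝ => xlnx (y - r)) ((Real.log (x - r) + 1) * 1) x :=
    hasDerivAt_xlnx_comp (h1.sub_const _) (by linarith)
  have hC : HasDerivAt (fun y : ℝ => xlnx (y + M + r)) ((Real.log (x + M + r) + 1) * 1) x :=
    hasDerivAt_xlnx_comp ((h1.add_const _).add_const _) (by positivity)
  have hD : HasDerivAt (fun y : ℝ => xlnx (y + M)) ((Real.log (x + M) + 1) * 1) x :=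
    hasDerivAt_xlnx_comp (h1.add_const _) (by positivity)
  have hE : ∀ j : Fin J, HasDerivAt (fun y : ℝ => xlnx (y + M - δ j)) ((Real.log (x + M - δ j) + 1) * 1) x :=
    fun j => hasDerivAt_xlnx_comp ((h1.add_const _).sub_const _) (by have := hδ' j; linarith)
  have hF : ∀ j : Fin J, HasDerivAt (fun y : ℝ => xlnx (y + δ j)) ((Real.log (x + δ j) + 1) * 1) x :=
    fun j => hasDerivAt_xlnx_comp (h1.add_const _) (by positivity)
  have hS : HasDerivAt (fun y : ℝ => ∑ j : Fin J, (xlnx (y + M - δ j) - xlnx (y + δ j)))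
      (∑ j : Fin J, ((Real.log (x + M - δ j) + 1) * 1 - (Real.log (x + δ j) + 1) * 1)) x :=
    HasDerivAt.fun_sum fun j _ => (hE j).sub (hF j)
  have h := (((((hasDerivAt_const x (∑ j : Fin J, xlnx ((M : ℝ) - 2 * (δ j : ℝ)))).fun_add hA).fun_sub
    hB).fun_add hC).fun_sub hD).fun_sub hS
  refine (show HasDerivAt (laiProfile J r M δ) _ x from h).congr_deriv ?_
  simp only [laiProfileDeriv, mul_one, zero_add, sum_sub_distrib, sum_add_distrib, sum_const, card_univ,
    Fintype.card_fin]
  ring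

/-- **DECAY-L1 Lemma 2.2, second half**: `f'(x) = log L(x) − log R(x)` for `x > r`. [this file] -/
theorem laiProfileDeriv_eq (hδ : ∀ j, δ j ≤ M) {x : ℝ} (hx : (r : ℝ) < x) :
    laiProfileDeriv J r M δ x = Real.log (laiProfL J r M δ x) - Real.log (laiProfR J r M δ x) := by
  have hx0 : 0 < x := lt_of_le_of_lt (Nat.cast_nonneg r) hx
  have hδ' : ∀ j, (δ j : ℝ) ≤ M := fun j => by exact_mod_cast hδ j
  have hxr : 0 < x - r := by linarith
  have hp1 : 0 < ∏ j : Fin J, (x + δ j) := prod_pos fun j _ => by positivity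
  have hp2 : 0 < ∏ j : Fin J, (x + M - δ j) := prod_pos fun j _ => by have := hδ' j; linarith
  unfold laiProfileDeriv laiProfL laiProfR
  rw [Real.log_mul (by positivity) hp1.ne', Real.log_mul hx0.ne' (by positivity),
    Real.log_prod (fun j _ => (by positivity : x + (δ j : ℝ) ≠ 0)),
    Real.log_mul (by positivity) hp2.ne', Real.log_mul hxr.ne' (by positivity),
    Real.log_prod (fun j _ => (by have := hδ' j; linarith : x + M - (δ j : ℝ) ≠ 0)), sum_sub_distrib]
  ring

/-! ### Sign of `L − R` ⇒ the maximum -/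

/-- **The maximum from the sign pattern**: if `R ≤ L` on `(r, r+X₀)` and `L ≤ R` on `(r+X₀, ∞)` then
`f ≤ f(r+X₀)` on `(r, ∞)` (mean value theorem). [this file] -/
theorem laiProfile_isMax_of_sign (hδ : ∀ j, δ j ≤ M) {X₀ : ℝ} (hX₀ : 0 < X₀)
    (hup : ∀ x : ℝ, (r : ℝ) < x → x < r + X₀ → laiProfR J r M δ x ≤ laiProfL J r M δ x)
    (hdown : ∀ x : ℝ, (r : ℝ) + X₀ < x → laiProfL J r M δ x ≤ laiProfR J r M δ x) :
    ∀ x : ℝ, (r : ℝ) < x → laiProfile J r M δ x ≤ laiProfile J r M δ (r + X₀) := by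
  have hcont := continuous_laiProfile J r M δ
  have hmono : MonotoneOn (laiProfile J r M δ) (Ioc (r : ℝ) (r + X₀)) := by
    refine monotoneOn_of_hasDerivWithinAt_nonneg (f' := laiProfileDeriv J r M δ) (convex_Ioc _ _)
      hcont.continuousOn (fun x hx => ?_)
      (fun x hx => ?_)
    · rw [interior_Ioc] at hx ⊢
      exact (hasDerivAt_laiProfile hδ hx.1).hasDerivWithinAt
    · rw [interior_Ioc] at hx
      rw [laiProfileDeriv_eq hδ hx.1]
      exact sub_nonneg.2 (Real.log_le_log (laiProfR_pos hδ hx.1) (hup x hx.1 hx.2))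
  have hanti : AntitoneOn (laiProfile J r M δ) (Ici ((r : ℝ) + X₀)) := by
    refine antitoneOn_of_hasDerivWithinAt_nonpos (f' := laiProfileDeriv J r M δ) (convex_Ici _)
      hcont.continuousOn (fun x hx => ?_)
      (fun x hx => ?_)
    · rw [interior_Ici] at hx ⊢
      exact (hasDerivAt_laiProfile hδ (by simp only [Set.mem_Ioi] at hx; linarith)).hasDerivWithinAt
    · rw [interior_Ici, Set.mem_Ioi] at hx
      have hx' : (r : ℝ) < x := by linarith
      rw [laiProfileDeriv_eq hδ hx']
      exact sub_nonpos.2 (Real.log_le_log (laiProfL_pos (by linarith [(Nat.cast_nonneg r : (0 : ℝ) ≤ r)]))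
        (hdown x hx))
  intro x hx
  rcases le_or_gt x (r + X₀) with h | h
  · exact hmono ⟨hx, h⟩ ⟨by linarith, le_rfl⟩ h
  · exact hanti Set.self_mem_Ici h.le h.le

/-! ### From the tree's kernel certificate `domCheck` -/

/-- The certificate makes `evalL a − evalL b` strictly decreasing on `[0, ∞)` (the argument inside
`LaiBoxUnimodal.existsUnique_pos_root_of_domCheck`, exported). [this file] -/
theorem strictAnti_of_domCheck {a b : List ℕ} (h : domCheck a b = true) :
    ∀ X Y : ℝ, 0 ≤ X → X < Y → evalL a Y - evalL b Y < evalL a X - evalL b X := by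
  match a, b, h with
  | a0 :: a1 :: p, b0 :: b1 :: q, h =>
    simp only [domCheck, Bool.and_eq_true, decide_eq_true_eq] at h
    obtain ⟨⟨_, h1⟩, ht⟩ := h
    set D : ℝ → ℝ := fun x => evalL (b1 :: q) x - evalL (a1 :: p) x with hD
    have hD1 : ∀ x : ℝ, 0 ≤ x → 1 ≤ D x := fun x hx => one_le_diff_of_tailDom ht h1 x hx
    have hDm : ∀ x y : ℝ, 0 ≤ x → x ≤ y → D x ≤ D y := (tailDom_nonneg_mono ht).2
    have hg : ∀ x : ℝ, evalL (a0 :: a1 :: p) x - evalL (b0 :: b1 :: q) x = ((a0 : ℝ) - b0) - x * D x := by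
      intro x; simp only [hD, evalL]; ring
    intro x y hx hxy
    rw [hg, hg]
    have hy : 0 ≤ y := hx.trans hxy.le
    have h2 : x * D x ≤ x * D y := mul_le_mul_of_nonneg_left (hDm x y hx hxy.le) hx
    have h3 : x * D y < y * D y := mul_lt_mul_of_pos_right hxy (by linarith [hD1 y hy])
    linarith

/-- `L(r+X)` is the `laiA` side of the balance equation. [this file] -/
theorem laiA_prod_eq (X : ℝ) :
    ((laiA r M (List.ofFn δ)).map (fun c : ℕ => (c : ℝ) + X)).prod = laiProfL J r M δ (r + X) := by
  simp only [laiA, List.map_cons, List.prod_cons, List.map_ofFn, List.prod_ofFn, Function.comp_apply, laiProfL]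
  push_cast
  rw [prod_congr rfl fun j _ => (by ring : (r : ℝ) + (δ j : ℝ) + X = (r : ℝ) + X + δ j)]
  ring

/-- `R(r+X)` is the `laiB` side of the balance equation (`δ_j ≤ M`). [this file] -/
theorem laiB_prod_eq (hδ : ∀ j, δ j ≤ M) (X : ℝ) :
    ((laiB r M (List.ofFn δ)).map (fun c : ℕ => (c : ℝ) + X)).prod = laiProfR J r M δ (r + X) := by
  simp only [laiB, List.map_cons, List.prod_cons, List.map_ofFn, List.prod_ofFn, Function.comp_apply, laiProfR]
  rw [prod_congr rfl fun j _ => (by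
    rw [Nat.cast_sub (by have := hδ j; omega)]; push_cast; ring :
      ((r + M - δ j : ℕ) : ℝ) + X = (r : ℝ) + X + M - δ j)]
  push_cast
  ring

/-- **`isMax` from the kernel certificate** (generic ladder point): `domCheck` on Lai's balance polynomials and
`δ_j ≤ M` give the balance root `X₀ > 0` with `f ≤ f(r + X₀)` on `(r, ∞)`. [this file] -/
theorem laiProfile_isMax_of_domCheck (hδ : ∀ j, δ j ≤ M)
    (hdom : domCheck (linProdCoeffs (laiA r M (List.ofFn δ))) (linProdCoeffs (laiB r M (List.ofFn δ))) = true) :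
    ∃ X₀ : ℝ, 0 < X₀ ∧ laiProfL J r M δ (r + X₀) = laiProfR J r M δ (r + X₀) ∧
      ∀ x : ℝ, (r : ℝ) < x → laiProfile J r M δ x ≤ laiProfile J r M δ (r + X₀) := by
  obtain ⟨X₀, ⟨hX₀, hroot⟩, -⟩ := existsUnique_pos_root_of_domCheck hdom
  have hanti := strictAnti_of_domCheck hdom
  simp only [evalL_linProdCoeffs, laiA_prod_eq, laiB_prod_eq hδ] at hroot hanti
  refine ⟨X₀, hX₀, hroot, laiProfile_isMax_of_sign hδ hX₀ (fun x hx hxlt => ?_) (fun x hx => ?_)⟩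
  · have h := hanti (x - r) X₀ (by linarith) (by linarith)
    rw [show (r : ℝ) + (x - r) = x by ring] at h
    linarith
  · have h := hanti X₀ (x - r) hX₀.le (by linarith)
    rw [show (r : ℝ) + (x - r) = x by ring] at h
    linarith

/-! ### The ladder point `(74, 2180, 444, delta74)` -/

/-- **κ₃ LADDER POINT — `isMax` discharged.** For any `δ : Fin 74 → ℕ` listing the tree's `delta74`, the sum-side
profile `laiProfile 74 2180 444 δ` attains its maximum over `(2180, ∞)` at `2180 + X₀`, `X₀ > 0` the (unique, tree
`laiBalance74_existsUnique_pos_root`) balance root — by the kernel certificate `domCheck74` (p241620).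
MANUSCRIPT-LEVEL CANDIDATE context; no decay / margin claim. [this file] -/
theorem kappa3_profile_isMax (δ : Fin 74 → ℕ) (hδ : List.ofFn δ = delta74) :
    ∃ X₀ : ℝ, 0 < X₀ ∧ laiProfL 74 2180 444 δ (2180 + X₀) = laiProfR 74 2180 444 δ (2180 + X₀) ∧
      ∀ x : ℝ, (2180 : ℝ) < x → laiProfile 74 2180 444 δ x ≤ laiProfile 74 2180 444 δ (2180 + X₀) := by
  have hmem : ∀ j, δ j ∈ delta74 := fun j => hδ ▸ List.mem_ofFn.2 ⟨j, rfl⟩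
  have hall : ∀ d ∈ delta74, d ≤ 444 := by decide
  have hδM : ∀ j, δ j ≤ 444 := fun j => hall _ (hmem j)
  have hdom : domCheck (linProdCoeffs (laiA 2180 444 (List.ofFn δ))) (linProdCoeffs (laiB 2180 444 (List.ofFn δ)))
      = true := by rw [hδ]; exact domCheck74
  simpa using laiProfile_isMax_of_domCheck (J := 74) (r := 2180) (M := 444) hδM hdom

end

end Summit.KontsevichZagierPeriods.Zeta5Search
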